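import Summits.CriticalPhenomena.PercolationContinuityZ3.Theorems.PercNearOneGluingNoHeavyRsw3LargestClusterDensityLimit
import Literature.Probability.Exchangeability.LimitStatistic
import HarnessLib

/-!
# RSW3 lane (P2, gen 23): THE DENSITY OF THE INFINITE CLUSTER, I — second moment of a count of equiprobable events with a
# bounded dependency neighbourhood (abstract probability; every measure)

builds on p205010 (kernel theorem, internal audit signed; external expert review pending) — NOT used in this file.

Cell `prim-rsw3`, prover seat `prim-rsw3-p2` (gen 23), memo `run/shared/lean/prim/rsw3/P2-RSWLITE.md` §30.
Support file (`--supports stmt-CriticalPhenomena-4575`); no definitions, no named facts, no sorries.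

The engine of the gen-23 laws of large numbers (parts II–IV: local arm densities, the density of the infinite cluster, the giant
component of the box).  For a probability measure `μ`, a finite index set `S`, events `A_i` (`i ∈ S`) all of probability `q`, and
'neighbourhoods' `near i` with at most `D` members such that `A_i, A_j` are independent whenever `j ∉ near i`, the count
`X = #{i ∈ S : A_i}` satisfies

* `integral_card_filter_mem_eq_sum_real` — `E X = Σ_{i∈S} μ(A_i)`;
* `sq_card_filter_mem_eq_card_filter_prod` — `X² = #{(i,j) ∈ S × S : A_i ∩ A_j}` (pointwise);
* **`integral_sq_card_filter_sub_le`** — `E (X − |S|q)² ≤ |S|·D·q` (`= Σ_{i,j}(μ(A_i∩A_j) − q²)`; far pairs contribute `0`, near pairs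
  at most `q` each);
* **`real_le_abs_card_filter_sub_le`** — Chebyshev: `μ(t ≤ |X − |S|q|) ≤ |S|Dq/t²`;
* **`integral_abs_card_filter_sub_le`** — `E|X − |S|q| ≤ a/2 + |S|Dq/(2a)` for every `a > 0` (the tree's `|y| ≤ a/2 + y²/(2a)`,
  `Literature.Probability.Exchangeability.abs_le_half_add_sq_div`).

References: standard second-moment / Chebyshev bookkeeping for finite-range dependent indicators (e.g. G. Grimmett, *Percolation* (1999),
§2.2 'events depending on disjoint edge sets are independent'; C. M. Newman, L. S. Schulman, J. Stat. Phys. 26 (1981) 613–628, §3).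
[folklore]
-/

noncomputable section

namespace Summit.CriticalPhenomena.PercolationContinuityZ3.Theorems

namespace Rsw3

open MeasureTheory Finset

variable {Ω ι : Type*} [MeasurableSpace Ω]

open Classical in
/-- The count `#{i ∈ S : ω ∈ A_i}` is a measurable function of `ω` (finite sum of indicators). [folklore] -/
theorem measurable_card_filter_mem (S : Finset ι) (A : ι → Set Ω) (hA : ∀ i ∈ S, MeasurableSet (A i)) :
    Measurable fun ω : Ω => ((S.filter fun i => ω ∈ A i).card : ℝ) := by
  classical
  have h : (fun ω : Ω => ((S.filter fun i => ω ∈ A i).card : ℝ)) = fun ω => ∑ i ∈ S, (A i).indicator 1 ω :=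
    funext fun ω => card_filter_mem_eq_sum_indicator S A ω
  rw [h]
  exact Finset.measurable_sum _ fun i hi => (measurable_const.indicator (hA i hi))

open Classical in
/-- The count is bounded by `|S|`, hence every power of it is integrable for a finite measure. [folklore] -/
theorem integrable_card_filter_mem_pow (μ : Measure Ω) [IsFiniteMeasure μ] (S : Finset ι) (A : ι → Set Ω)
    (hA : ∀ i ∈ S, MeasurableSet (A i)) (t : ℕ) :
    Integrable (fun ω : Ω => ((S.filter fun i => ω ∈ A i).card : ℝ) ^ t) μ := by
  classical
  refine (integrable_const (((S.card : ℝ)) ^ t)).mono' ((measurable_card_filter_mem S A hA).pow_const t).aestronglyMeasurable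
    (Filter.Eventually.of_forall fun ω => ?_)
  have h0 : (0 : ℝ) ≤ ((S.filter fun i => ω ∈ A i).card : ℝ) := Nat.cast_nonneg _
  rw [Real.norm_eq_abs, abs_of_nonneg (pow_nonneg h0 t)]
  exact pow_le_pow_left₀ h0 (by exact_mod_cast Finset.card_filter_le _ _) t

open Classical in
/-- **`E #{i ∈ S : A_i} = Σ_{i ∈ S} μ(A_i)`** (linearity). [folklore] -/
theorem integral_card_filter_mem_eq_sum_real (μ : Measure Ω) [IsFiniteMeasure μ] (S : Finset ι) (A : ι → Set Ω)
    (hA : ∀ i ∈ S, MeasurableSet (A i)) :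
    ∫ ω, ((S.filter fun i => ω ∈ A i).card : ℝ) ∂μ = ∑ i ∈ S, μ.real (A i) := by
  classical
  have hpt : ∀ ω : Ω, ((S.filter fun i => ω ∈ A i).card : ℝ) = ∑ i ∈ S, (A i).indicator 1 ω :=
    fun ω => card_filter_mem_eq_sum_indicator S A ω
  have hind : ∀ i ∈ S, Integrable ((A i).indicator (1 : Ω → ℝ)) μ := fun i hi => (integrable_const (1 : ℝ)).indicator (hA i hi)
  simp_rw [hpt]
  rw [integral_finsetSum _ hind]
  exact Finset.sum_congr rfl fun i hi => integral_indicator_one (hA i hi)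

omit [MeasurableSpace Ω] in
open Classical in
/-- **`X² = #{(i,j) ∈ S × S : A_i ∩ A_j}`** pointwise: the square of a count is the count of ordered pairs. [folklore] -/
theorem sq_card_filter_mem_eq_card_filter_prod (S : Finset ι) (A : ι → Set Ω) (ω : Ω) :
    ((S.filter fun i => ω ∈ A i).card : ℝ) ^ 2 =
      (((S ×ˢ S).filter fun p : ι × ι => ω ∈ A p.1 ∩ A p.2).card : ℝ) := by
  classical
  have h : (S ×ˢ S).filter (fun p : ι × ι => ω ∈ A p.1 ∩ A p.2) =
      (S.filter fun i => ω ∈ A i) ×ˢ (S.filter fun i => ω ∈ A i) := by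
    rw [← Finset.filter_product]
    rfl
  rw [h, Finset.card_product, sq]
  push_cast
  rfl

open Classical in
/-- **SECOND MOMENT OF A COUNT WITH A BOUNDED DEPENDENCY NEIGHBOURHOOD**: `μ` a probability measure, `A_i` (`i ∈ S`) measurable events of
the same probability `q`, `near i` finite sets with `|near i| ≤ D`, and `μ(A_i ∩ A_j) = μ(A_i)μ(A_j)` whenever `j ∉ near i`.  Then
`E (#{i ∈ S : A_i} − |S|q)² ≤ |S|·D·q`.  Proof: `E(X − |S|q)² = Σ_{i,j∈S} (μ(A_i∩A_j) − q²)`; the far terms vanish and each of the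
`≤ |S|·D` near terms is `≤ μ(A_i) − q² ≤ q`. [folklore] -/
theorem integral_sq_card_filter_sub_le (μ : Measure Ω) [IsProbabilityMeasure μ] (S : Finset ι) (A : ι → Set Ω)
    (hA : ∀ i ∈ S, MeasurableSet (A i)) {q : ℝ} (hq : ∀ i ∈ S, μ.real (A i) = q)
    (near : ι → Finset ι) {D : ℕ} (hD : ∀ i ∈ S, (near i).card ≤ D)
    (hind : ∀ i ∈ S, ∀ j ∈ S, j ∉ near i → μ.real (A i ∩ A j) = μ.real (A i) * μ.real (A j)) :
    ∫ ω, (((S.filter fun i => ω ∈ A i).card : ℝ) - S.card * q) ^ 2 ∂μ ≤ S.card * D * q := by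
  classical
  set X : Ω → ℝ := fun ω => ((S.filter fun i => ω ∈ A i).card : ℝ) with hX
  set m : ℝ := S.card * q with hm
  -- integrability
  have hX1 : Integrable X μ := (integrable_card_filter_mem_pow μ S A hA 1).congr (Filter.Eventually.of_forall fun ω => pow_one _)
  have hX2 : Integrable (fun ω => X ω ^ 2) μ := integrable_card_filter_mem_pow μ S A hA 2
  -- first moment
  have hEX : ∫ ω, X ω ∂μ = m := by
    rw [hX, hm]
    simp only
    rw [integral_card_filter_mem_eq_sum_real μ S A hA, Finset.sum_congr rfl hq, Finset.sum_const, nsmul_eq_mul]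
  -- second moment
  have hAA : ∀ p ∈ S ×ˢ S, MeasurableSet (A p.1 ∩ A p.2) := fun p hp =>
    (hA p.1 (Finset.mem_product.1 hp).1).inter (hA p.2 (Finset.mem_product.1 hp).2)
  have hEX2 : ∫ ω, X ω ^ 2 ∂μ = ∑ p ∈ S ×ˢ S, μ.real (A p.1 ∩ A p.2) := by
    rw [hX]
    simp only
    simp_rw [sq_card_filter_mem_eq_card_filter_prod S A]
    convert integral_card_filter_mem_eq_sum_real μ (S ×ˢ S) (fun p : ι × ι => A p.1 ∩ A p.2) hAA
  -- expand the square
  have hexp : ∫ ω, (X ω - m) ^ 2 ∂μ = (∑ p ∈ S ×ˢ S, μ.real (A p.1 ∩ A p.2)) - m ^ 2 := by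
    have hpt : (fun ω => (X ω - m) ^ 2) = fun ω => X ω ^ 2 - (2 * m) * X ω + m ^ 2 := by
      funext ω; ring
    have h1 : Integrable (fun ω => X ω ^ 2 - 2 * m * X ω) μ := hX2.sub (hX1.const_mul (2 * m))
    rw [hpt, integral_add h1 (integrable_const _), integral_sub hX2 (hX1.const_mul (2 * m)),
      integral_const_mul, integral_const, hEX, hEX2]
    simp only [probReal_univ, smul_eq_mul, one_mul]
    ring
  -- `m² = Σ_{S×S} q²`
  have hm2 : m ^ 2 = ∑ p ∈ S ×ˢ S, q * q := by
    rw [Finset.sum_const, Finset.card_product, nsmul_eq_mul, hm]; push_cast; ring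
  change ∫ ω, (X ω - m) ^ 2 ∂μ ≤ S.card * D * q
  rw [hexp, hm2, ← Finset.sum_sub_distrib, Finset.sum_product]
  -- termwise bound
  have hq0 : ∀ i ∈ S, 0 ≤ q := fun i hi => by rw [← hq i hi]; exact measureReal_nonneg
  have hrow : ∀ i ∈ S, ∑ j ∈ S, (μ.real (A i ∩ A j) - q * q) ≤ D * q := by
    intro i hi
    have hqi : 0 ≤ q := hq0 i hi
    calc ∑ j ∈ S, (μ.real (A i ∩ A j) - q * q)
        ≤ ∑ j ∈ S, (if j ∈ near i then q else 0) := by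
          refine Finset.sum_le_sum fun j hj => ?_
          split_ifs with hnear
          · have h1 : μ.real (A i ∩ A j) ≤ μ.real (A i) := measureReal_mono Set.inter_subset_left
            rw [hq i hi] at h1
            nlinarith
          · rw [hind i hi j hj hnear, hq i hi, hq j hj]; simp
      _ = ((S.filter fun j => j ∈ near i).card : ℝ) * q := by
          rw [Finset.sum_ite, Finset.sum_const_zero, add_zero, Finset.sum_const, nsmul_eq_mul]
      _ ≤ D * q := by
          refine mul_le_mul_of_nonneg_right ?_ hqi
          have h1 : (S.filter fun j => j ∈ near i).card ≤ (near i).card :=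
            Finset.card_le_card fun j hj => (Finset.mem_filter.1 hj).2
          exact_mod_cast h1.trans (hD i hi)
  calc ∑ i ∈ S, ∑ j ∈ S, (μ.real (A (i, j).1 ∩ A (i, j).2) - q * q)
      ≤ ∑ i ∈ S, (D : ℝ) * q := Finset.sum_le_sum fun i hi => hrow i hi
    _ = S.card * D * q := by rw [Finset.sum_const, nsmul_eq_mul]; ring

open Classical in
/-- **Chebyshev**: under the hypotheses of `integral_sq_card_filter_sub_le`, for every `t > 0`,
`μ( t ≤ |#{i ∈ S : A_i} − |S|q| ) ≤ |S|·D·q / t²`. [folklore] -/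
theorem real_le_abs_card_filter_sub_le (μ : Measure Ω) [IsProbabilityMeasure μ] (S : Finset ι) (A : ι → Set Ω)
    (hA : ∀ i ∈ S, MeasurableSet (A i)) {q : ℝ} (hq : ∀ i ∈ S, μ.real (A i) = q)
    (near : ι → Finset ι) {D : ℕ} (hD : ∀ i ∈ S, (near i).card ≤ D)
    (hind : ∀ i ∈ S, ∀ j ∈ S, j ∉ near i → μ.real (A i ∩ A j) = μ.real (A i) * μ.real (A j))
    {t : ℝ} (ht : 0 < t) :
    μ.real {ω | t ≤ |((S.filter fun i => ω ∈ A i).card : ℝ) - S.card * q|} ≤ S.card * D * q / t ^ 2 := by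
  classical
  set X : Ω → ℝ := fun ω => ((S.filter fun i => ω ∈ A i).card : ℝ) with hX
  set m : ℝ := S.card * q with hm
  have hX1 : Integrable X μ := (integrable_card_filter_mem_pow μ S A hA 1).congr (Filter.Eventually.of_forall fun ω => pow_one _)
  have hint : Integrable (fun ω => (X ω - m) ^ 2) μ := by
    have hpt : (fun ω => (X ω - m) ^ 2) = fun ω => X ω ^ 2 - (2 * m) * X ω + m ^ 2 := by funext ω; ring
    rw [hpt]
    exact ((integrable_card_filter_mem_pow μ S A hA 2).sub (hX1.const_mul _)).add (integrable_const _)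
  have hmarkov := mul_meas_ge_le_integral_of_nonneg (μ := μ) (Filter.Eventually.of_forall fun ω => sq_nonneg (X ω - m)) hint (t ^ 2)
  have hle := integral_sq_card_filter_sub_le μ S A hA hq near hD hind
  have hset : {ω | t ≤ |X ω - m|} = {ω | t ^ 2 ≤ (X ω - m) ^ 2} := by
    ext ω
    simp only [Set.mem_setOf_eq]
    constructor
    · intro h; calc t ^ 2 ≤ |X ω - m| ^ 2 := pow_le_pow_left₀ ht.le h 2
        _ = (X ω - m) ^ 2 := sq_abs _
    · intro h
      have h' : t ^ 2 ≤ |X ω - m| ^ 2 := by rwa [sq_abs]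
      exact (pow_le_pow_iff_left₀ ht.le (abs_nonneg _) two_ne_zero).1 h'
  have htpos : (0 : ℝ) < t ^ 2 := by positivity
  change μ.real {ω | t ≤ |X ω - m|} ≤ S.card * D * q / t ^ 2
  rw [hset, le_div_iff₀ htpos, mul_comm]
  exact hmarkov.trans hle

open Classical in
/-- **`L¹` form**: under the hypotheses of `integral_sq_card_filter_sub_le`, for every `a > 0`,
`E |#{i ∈ S : A_i} − |S|q| ≤ a/2 + |S|·D·q/(2a)`. [folklore] -/
theorem integral_abs_card_filter_sub_le (μ : Measure Ω) [IsProbabilityMeasure μ] (S : Finset ι) (A : ι → Set Ω)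
    (hA : ∀ i ∈ S, MeasurableSet (A i)) {q : ℝ} (hq : ∀ i ∈ S, μ.real (A i) = q)
    (near : ι → Finset ι) {D : ℕ} (hD : ∀ i ∈ S, (near i).card ≤ D)
    (hind : ∀ i ∈ S, ∀ j ∈ S, j ∉ near i → μ.real (A i ∩ A j) = μ.real (A i) * μ.real (A j))
    {a : ℝ} (ha : 0 < a) :
    ∫ ω, |((S.filter fun i => ω ∈ A i).card : ℝ) - S.card * q| ∂μ ≤ a / 2 + S.card * D * q / (2 * a) := by
  classical
  set X : Ω → ℝ := fun ω => ((S.filter fun i => ω ∈ A i).card : ℝ) with hX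
  set m : ℝ := S.card * q with hm
  have hX1 : Integrable X μ := (integrable_card_filter_mem_pow μ S A hA 1).congr (Filter.Eventually.of_forall fun ω => pow_one _)
  have hint : Integrable (fun ω => (X ω - m) ^ 2) μ := by
    have hpt : (fun ω => (X ω - m) ^ 2) = fun ω => X ω ^ 2 - (2 * m) * X ω + m ^ 2 := by funext ω; ring
    rw [hpt]
    exact ((integrable_card_filter_mem_pow μ S A hA 2).sub (hX1.const_mul _)).add (integrable_const _)
  have hle := integral_sq_card_filter_sub_le μ S A hA hq near hD hind
  have hbound : Integrable (fun ω => a / 2 + (X ω - m) ^ 2 / (2 * a)) μ := (integrable_const _).add (hint.div_const _)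
  change ∫ ω, |X ω - m| ∂μ ≤ a / 2 + S.card * D * q / (2 * a)
  calc ∫ ω, |X ω - m| ∂μ ≤ ∫ ω, (a / 2 + (X ω - m) ^ 2 / (2 * a)) ∂μ :=
        integral_mono_of_nonneg (Filter.Eventually.of_forall fun ω => abs_nonneg _) hbound
          (Filter.Eventually.of_forall fun ω => Literature.Probability.Exchangeability.abs_le_half_add_sq_div ha)
    _ = a / 2 + (∫ ω, (X ω - m) ^ 2 ∂μ) / (2 * a) := by
        rw [integral_add (integrable_const _) (hint.div_const _), integral_const, integral_div]
        simp
    _ ≤ a / 2 + S.card * D * q / (2 * a) := by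
        have : (∫ ω, (X ω - m) ^ 2 ∂μ) / (2 * a) ≤ S.card * D * q / (2 * a) := div_le_div_of_nonneg_right hle (by positivity)
        linarith

end Rsw3

end Summit.CriticalPhenomena.PercolationContinuityZ3.Theorems
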